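import Summits.HodgeConjecture.HodgeConjecture.Theorems.F0P3LettersArchFinTraceSplit                -- ★ J1a (p836307): the letter frame (`IsProductHaar`, `Cls`, `rep`, `cptTriv₀`, `clInfChoiceU`, `HasFinComponent`, …)
import Summits.HodgeConjecture.HodgeConjecture.Theorems.F0P3ArchFixedBlockDecompositionOfAdmissible   -- ★ (A-p14 (g25), p838816): `exists_fin_orthogonal_blocks_of_admissible_of_descend`; brings FILE 3∕4∕5∕6b
import Literature.NumberTheory.Automorphic.UnitaryGlobalizationsInequivalentProofs                    -- ★ `areGKEquivalent_harishChandra_of_areUnitarilyEquivalent`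
import Literature.NumberTheory.Automorphic.FiniteMultiplicityCriterion                               -- ★ `ClosedSubrep.inflate`, `isOrtho_inflate_iff`, `isTopIrreducible_inflate_iff`, `areUnitarilyEquivalent_inflate`
import HarnessLib

/-!
# The structure letter H3 SPLITS: H3 ⟸ H3-core + L-adm + L-iso (ROAD «TF», J2; census (n1) of A-p14 (g25), RULING F0P3-plan (g7) 2026-09-01 00:55:41Z)

Cell `hodgecm-mathlib`, programme P3 «U3-mult», ROAD «TF».  F0P3a-p07 (g6)'s assembler `archFinTraceSplit_of_structure` takes ONE binder, the
structure letter H3 ([FlathCorvallis1979 Thm. 4] + [BorelJacquet1979 §4.3, §4.6] + [HarishChandra1953 Thms. 4–6]): in the letter frame, an irreducible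
admissible smooth `σ` of `U(H)(𝔸_f)` occurring in `rep c` and, for every compact open `K′`, finitely many closed `G′_∞`-invariant pairwise orthogonal
blocks `W_i ≤ rep c` descending along `archProjUForm` to unitary globalizations of `clInfChoiceU … (rep c)` with (a) every `K′`-fixed vector of `rep c`
in `⊕ W_i` and (b) `Σ_i ⟪u_i, R_f(Λ) u_i⟫ = σ.smoothTrace νf Λ` for bi-`K′`-invariant `Λ` and unit vectors `u_i ∈ W_i`.

THIS FILE proves `h3_of_core_of_adm_of_iso : ‹L-adm› → ‹L-iso› → ‹H3-core› → ‹H3 verbatim›` where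
* **H3-core** = H3 with the block clause turned into a ∀: (σ) as in H3, and (b) for EVERY block family `(n, W, σbar)` satisfying (orth, le, desc, glob, a)
  — loss-free by Schur (the sum `Σ_i ⟪u_i, R_f(Λ) u_i⟫` is the trace of `R_f(Λ)` on the multiplicity space, independent of the decomposition);
  print = [FlathCorvallis1979 Thm. 4] + [BorelJacquet1979 §4.6];
* **L-adm** = `K`-admissibility of the LEVEL-`K′` BLOCK `{w ∈ rep c | R(k) w = w ∀ k ∈ K′}` of `rep c` as a representation of `G′_∞` (for some compact
  Hausdorff `K →* G′_∞`, every occurring irreducible `K`-type has a finite-dimensional isotypic component) — token-exact the `hadm` binder of ★ p838816;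
  print = [HarishChandra1953 Thms. 4–6] + [BorelJacquet1979 §4.3];
* **L-iso** = CLASS ISOTOPY: every irreducible closed `G′_∞`-block `W ≤ rep c` is, under any descent `σbar` along `archProjUForm`, a unitary globalization
  of `clInfChoiceU … (rep c)`; print = [Dixmier1977 13.1.8] + [FlathCorvallis1979 Thms. 3–4] (the F1a `ArchIsotypy` content at the Hilbert-space level;
  its discharge from F1a + ★ `clInfChoiceU_eq_ofModule` + a coh-unitary `HasToken` is the F0P3-plan desk's (n1)-proper row, NOT claimed here).
The DESCENT of blocks is not a letter: `cptTriv₀ c` makes every block of `rep c` trivial on `ker archProjUForm` (★ `archProjUForm_ker`, ★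
`cmCompactFactor_eq`), so ★ p838350 `exists_descend_archProjUForm` descends it (`toContRep_eq_one_of_cptTriv₀`).

PROOF: per `K′`, build the level-`K′` block `B` (closed; `G′_∞`-invariant since `G′_∞` and `U(H)(𝔸_f)` commute, ★ `commute_archToAdelic_finAdelicToAdelic`),
apply ★ p838816 to `B.toContRep` (L-adm gives `hadm`; L-iso + descent + the transports of §0 along ★ `areUnitarilyEquivalent_inflate` give `hiso`), inflate
the resulting blocks to `L²` (★ `ClosedSubrep.inflate`: orthogonality ★ `isOrtho_inflate_iff`, irreducibility ★ `isTopIrreducible_inflate_iff`), descend them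
afresh, read (glob) from L-iso, (a) from `⨆ Wb_i = ⊤`, and (b) from H3-core.  THEOREMS ONLY, 0 def ∕ instance ∕ notation ∕ named fact ∕ sorry.
NON-CLAIMS (census §4): nothing is said about `IsCohUnitaryIrrep`'s «coh» clause or about definiteness of `H` away from `ι` (`K` in L-adm is abstract).
HONEST LABEL: HC_CM is proved only modulo the 2 remaining named inputs (hLiu418, h413) until rung 0 closes; this file discharges NO letter — it re-types
H3 as {H3-core, L-adm, L-iso} (count = the director's).

## References
* D. Flath, *Decomposition of representations into tensor products*, Corvallis 1979, part 1, Thm. 3 and Thm. 4 [FlathCorvallis1979].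
* A. Borel, H. Jacquet, *Automorphic forms and automorphic representations*, Corvallis 1979, part 1, §4.3 and §4.6 [BorelJacquet1979].
* Harish-Chandra, *Representations of a semisimple Lie group on a Banach space I*, Trans. AMS 75 (1953), §9 Thm. 4 (p. 224), §11 Thm. 8 (p. 231) [HarishChandraTAMS1953].
* J. Dixmier, *C\*-algebras* (1977), §13.1.2, §13.1.3, §13.1.5, §13.1.8 [Dixmier1977].
* A. Knapp, D. Vogan, *Cohomological Induction and Unitary Representations* (1995), §II.4 [KnappVogan1995].
-/

-- Mathlib idiom (as in ★ `GKModules`): commutator bracket, needed to MENTION `GKIrrClass (uFormGroup …)` ∕ `IsUnitaryGlobalization`.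
attribute [local instance 100] LieRing.ofAssociativeRing

set_option autoImplicit false
-- the mandated namespace repeats `HodgeConjecture.HodgeConjecture`, as in every `Theorems/*.lean` of this sub-problem
set_option linter.dupNamespace false

noncomputable section

open MeasureTheory Measure NumberField CompactlySupported Topology
open Literature.NumberTheory.Automorphic Literature.NumberTheory.Automorphic.UnitaryGroup
open Literature.NumberTheory.Automorphic.UnitaryGroup.CotangentForms
open Literature.RepresentationTheory Literature.RepresentationTheory.KonnoKonno2007 Literature.RepresentationTheory.KonnoKonno2007.RealDualPair
open scoped Matrix InnerProductSpace ENNReal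

namespace Summit.HodgeConjecture.HodgeConjecture.Cruxes.H413.F0P3ArchStructureLetterSplit

open Summit.HodgeConjecture.HodgeConjecture.Cruxes.H413.F0P3InnerFormClassificationV6
open Summit.HodgeConjecture.HodgeConjecture.Cruxes.H413.F0P3ClassTokensOfRecord (Cls rep)
open Summit.HodgeConjecture.HodgeConjecture.Cruxes.H413.F0P3CompactTrivOfRecord (cptTriv₀)
open Summit.HodgeConjecture.HodgeConjecture.Cruxes.H413.F0P3UnitaryLocOfRecord (clInfChoiceU)
open Summit.HodgeConjecture.HodgeConjecture.Cruxes.H413.F0P3bArchDegOneClass (archDegOneClass)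
open Summit.HodgeConjecture.HodgeConjecture.Cruxes.H413.F0P3LettersTraceFactorisation (IsProductHaar)
open Summit.HodgeConjecture.HodgeConjecture.Cruxes.H413.F0P3ArchTraceOfRealisation (exists_descend_archProjUForm isUnitary_of_descend isStronglyContinuous_of_descend)
open Summit.HodgeConjecture.HodgeConjecture.Cruxes.H413.F0P3ArchFixedBlockDecompositionOfAdmissible (exists_fin_orthogonal_blocks_of_admissible_of_descend)
open ContRepresentation (ClosedSubrep AreUnitarilyEquivalent)

/-! ## §0 Two transports (generic in the Hilbert spaces) -/

section Transport

variable (L : Type) [Field L] [NumberField L] [IsCMField L] (ι : L →+* ℂ) (H : Matrix (Fin 3) (Fin 3) L) (T : GL (Fin 3) ℂ)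
  (hT : (T : Matrix (Fin 3) (Fin 3) ℂ)ᴴ * H.map ι * (T : Matrix (Fin 3) (Fin 3) ℂ) = Literature.Geometry.ComplexHyperbolic.BallModel.J)

/-- Descents of unitarily equivalent representations of `G′_∞` along the surjection `archProjUForm` are unitarily equivalent (the same isometry intertwines).
[cite: BorelJacquetCorvallis1979, §4.1] [cite: Dixmier1977, §13.1.3] -/
theorem areUnitarilyEquivalent_of_descend_of_descend
    {F : Type*} [NormedAddCommGroup F] [InnerProductSpace ℂ F] [CompleteSpace F]
    {F' : Type*} [NormedAddCommGroup F'] [InnerProductSpace ℂ F'] [CompleteSpace F']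
    {ρ : ContRepresentation ℂ (arch (↥(maximalRealSubfield L)) L (IsCMField.complexConj L) 3 H) F}
    {ρ' : ContRepresentation ℂ (arch (↥(maximalRealSubfield L)) L (IsCMField.complexConj L) 3 H) F'}
    {σbar : ContRepresentation ℂ (uFormGroup (Fin 2) (Fin 1)).carrier F} {σbar' : ContRepresentation ℂ (uFormGroup (Fin 2) (Fin 1)).carrier F'}
    (h : ∀ g, ρ g = σbar (archProjUForm L ι H T hT g)) (h' : ∀ g, ρ' g = σbar' (archProjUForm L ι H T hT g)) (he : AreUnitarilyEquivalent ρ ρ') :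
    AreUnitarilyEquivalent σbar σbar' := by
  obtain ⟨e, hiso⟩ := he
  refine ⟨ContRepresentation.Equiv.mk e.toContinuousLinearEquiv (fun u => ?_), hiso⟩
  obtain ⟨g, rfl⟩ := archProjUForm_surjective L ι H T hT u
  rw [← h, ← h']
  exact e.isIntertwining g

/-- `IsUnitaryGlobalization x` is invariant under unitary equivalence (the Harish-Chandra modules are `(𝔤, K)`-equivalent, ★
`areGKEquivalent_harishChandra_of_areUnitarilyEquivalent`). [cite: HarishChandraTAMS1953, §9 and §11 Thm. 8 (p. 231)] [cite: KnappVogan1995, §II.4] -/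
theorem isUnitaryGlobalization_of_areUnitarilyEquivalent {x : GKIrrClass (uFormGroup (Fin 2) (Fin 1))}
    {F : Type} [NormedAddCommGroup F] [InnerProductSpace ℂ F] [CompleteSpace F]
    {F' : Type} [NormedAddCommGroup F'] [InnerProductSpace ℂ F'] [CompleteSpace F']
    {ϖ : ContRepresentation ℂ (uFormGroup (Fin 2) (Fin 1)).carrier F} {ϖ' : ContRepresentation ℂ (uFormGroup (Fin 2) (Fin 1)).carrier F'}
    (h : IsUnitaryGlobalization (uFormGroup (Fin 2) (Fin 1)) x ϖ) (hu' : ϖ'.IsUnitary) (hc' : ϖ'.IsStronglyContinuous)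
    (he : AreUnitarilyEquivalent ϖ' ϖ) : IsUnitaryGlobalization (uFormGroup (Fin 2) (Fin 1)) x ϖ' := by
  obtain ⟨-, hc, r, hr, hxr⟩ := h
  exact ⟨hu', hc', r, hr, (areGKEquivalent_harishChandra_of_areUnitarilyEquivalent (uFormGroup (Fin 2) (Fin 1)) hc' hc he).trans hxr⟩

/-- **Descent of a block** (one ambient level, generic Hilbert space): if `π` is trivial on `ker archProjUForm`, every closed block `W ≤ π` descends along
`archProjUForm` (★ `exists_descend_archProjUForm`). [cite: BorelJacquetCorvallis1979, §4.1] -/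
theorem exists_descend_toContRep
    {E : Type} [NormedAddCommGroup E] [InnerProductSpace ℂ E] [CompleteSpace E]
    {π : ContRepresentation ℂ (arch (↥(maximalRealSubfield L)) L (IsCMField.complexConj L) 3 H) E}
    (hker : ∀ g, archProjUForm L ι H T hT g = 1 → π g = 1) (W : ClosedSubrep π) :
    ∃ σbar : ContRepresentation ℂ (uFormGroup (Fin 2) (Fin 1)).carrier W.toSubmodule, ∀ g, W.toContRep g = σbar (archProjUForm L ι H T hT g) := by
  refine exists_descend_archProjUForm L ι H T hT W.toContRep fun g hg => ?_
  refine ContinuousLinearMap.ext fun v => Subtype.ext ?_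
  change ((W.toContRep g v : W.toSubmodule) : E) = (v : E)
  rw [ClosedSubrep.coe_toContRep_apply, hker g hg]
  rfl

/-- **Class of a block from an equivalent realisation** (one ambient level): if the closed block `W ≤ π` (`π` unitary, strongly continuous) descends to `σbar`, and
`W.toContRep` is unitarily equivalent to a representation `ρ'` descending to a unitary globalization `σ'` of `x`, then `σbar` is a unitary globalization of `x`.
[cite: HarishChandraTAMS1953, §11 Thm. 8 (p. 231)] [cite: Dixmier1977, §13.1.3] -/
theorem isUnitaryGlobalization_of_descend_of_areUnitarilyEquivalent {x : GKIrrClass (uFormGroup (Fin 2) (Fin 1))}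
    {E : Type} [NormedAddCommGroup E] [InnerProductSpace ℂ E] [CompleteSpace E]
    {π : ContRepresentation ℂ (arch (↥(maximalRealSubfield L)) L (IsCMField.complexConj L) 3 H) E} (hu : π.IsUnitary) (hc : π.IsStronglyContinuous)
    (W : ClosedSubrep π) {σbar : ContRepresentation ℂ (uFormGroup (Fin 2) (Fin 1)).carrier W.toSubmodule}
    (hσ : ∀ g, W.toContRep g = σbar (archProjUForm L ι H T hT g))
    {F' : Type} [NormedAddCommGroup F'] [InnerProductSpace ℂ F'] [CompleteSpace F']
    {ρ' : ContRepresentation ℂ (arch (↥(maximalRealSubfield L)) L (IsCMField.complexConj L) 3 H) F'}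
    {σ' : ContRepresentation ℂ (uFormGroup (Fin 2) (Fin 1)).carrier F'} (hσ' : ∀ g, ρ' g = σ' (archProjUForm L ι H T hT g))
    (he : AreUnitarilyEquivalent W.toContRep ρ') (hglob' : IsUnitaryGlobalization (uFormGroup (Fin 2) (Fin 1)) x σ') :
    IsUnitaryGlobalization (uFormGroup (Fin 2) (Fin 1)) x σbar := by
  have hWu : W.toContRep.IsUnitary := hu.toContRep W
  have hWc : W.toContRep.IsStronglyContinuous := fun v => by
    have h1 : Continuous fun g => ((W.toContRep g v : W.toSubmodule) : E) := by
      simp only [ClosedSubrep.coe_toContRep_apply]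
      exact hc (v : E)
    exact continuous_induced_rng.2 h1
  exact isUnitaryGlobalization_of_areUnitarilyEquivalent hglob' (isUnitary_of_descend L ι H T hT hσ hWu)
    (isStronglyContinuous_of_descend L ι H T hT hσ hWc) (areUnitarilyEquivalent_of_descend_of_descend L ι H T hT hσ hσ' he)

end Transport

/-! ## §1 The split -/

variable (L : Type) [Field L] [NumberField L] [IsCMField L] (H : Matrix (Fin 3) (Fin 3) L) (ι : L →+* ℂ) (T : GL (Fin 3) ℂ)
  (hT : (T : Matrix (Fin 3) (Fin 3) ℂ)ᴴ * H.map ι * (T : Matrix (Fin 3) (Fin 3) ℂ) = Literature.Geometry.ComplexHyperbolic.BallModel.J)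
  (μ : Measure (Gp L H).automorphicQuotient) [(Gp L H).IsAutomorphicMeasure μ]

/-- **Blocks of `rep c` are trivial on the compact archimedean factor** (`cptTriv₀ c`): a closed `G′_∞`-block `W ≤ (rep c).space` satisfies `W(g) = 1` whenever
`archProjUForm g = 1` (★ `archProjUForm_ker`, ★ `cmCompactFactor_eq`). [cite: Rogawski1990, §14.6 p. 244] [cite: BorelJacquetCorvallis1979, §4.1] -/
theorem toContRep_eq_one_of_cptTriv₀ (c : Cls (Gp L H) μ) (hc : cptTriv₀ L ι H T hT μ c)
    (W : ClosedSubrep (((Gp L H).rightRegular μ).restrict (archToAdelic (↥(maximalRealSubfield L)) L (IsCMField.complexConj L) 3 H)))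
    (hW : W.toSubmodule ≤ (rep (Gp L H) μ c).space.toSubmodule)
    (g : arch (↥(maximalRealSubfield L)) L (IsCMField.complexConj L) 3 H) (hg : archProjUForm L ι H T hT g = 1) : W.toContRep g = 1 := by
  have hmem : archToAdelic (↥(maximalRealSubfield L)) L (IsCMField.complexConj L) 3 H g ∈ cmCompactFactor L ι H T hT := by
    rw [cmCompactFactor_eq]
    refine Subgroup.mem_map.2 ⟨g, ?_, rfl⟩
    rw [← archProjUForm_ker L ι H T hT]
    exact hg
  refine ContinuousLinearMap.ext fun v => Subtype.ext ?_
  change ((W.toContRep g v : W.toSubmodule) : (Gp L H).L2 μ) = (v : (Gp L H).L2 μ)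
  rw [ClosedSubrep.coe_toContRep_apply]
  exact hc _ hmem ⟨(v : (Gp L H).L2 μ), hW v.2⟩

variable [MeasurableSpace (Gp L H).Adelic] (ν : Measure (Gp L H).Adelic)
  (νinf : @Measure (UnitaryGroup.arch (↥(maximalRealSubfield L)) L (IsCMField.complexConj L) 3 H) (borel _))
  (μv : ∀ v : Places L, @Measure ((cmDatum L 3 H).Local v) (borel _))

-- one long statement (the letter H3 twice) and several instance-path unifications `ClosedSubrep B.toContRep` ↔ ★ p838816's spelling
set_option maxHeartbeats 3200000 in
/-- **H3 ⟸ H3-core + L-adm + L-iso.**  Hypotheses (module docstring): `hadm` = L-adm (K-admissibility of every level-`K′` block of every `cptTriv₀` class, for some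
compact Hausdorff `K →* G′_∞`), `hiso` = L-iso (class isotopy of irreducible closed `G′_∞`-blocks of `rep c` under any descent), `hcore` = H3-core ((σ) + the trace
identity (b) for EVERY admissible block family).  Conclusion: the structure letter H3 VERBATIM (the binder of F0P3a-p07 (g6)'s `archFinTraceSplit_of_structure`).
[cite: FlathCorvallis1979, Thm. 3 and Thm. 4] [cite: BorelJacquet1979, §4.3 and §4.6] [cite: HarishChandraTAMS1953, §9 Thm. 4 (p. 224), §11 Thm. 8 (p. 231)]
[cite: Dixmier1977, §13.1.2, §13.1.5, §13.1.8] -/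
theorem h3_of_core_of_adm_of_iso
    (hadm : ∀ c : Cls (Gp L H) μ, cptTriv₀ L ι H T hT μ c →
      ∀ (K' : Subgroup (finAdelic (↥(maximalRealSubfield L)) L (IsCMField.complexConj L) 3 H)),
        IsOpen (K' : Set (finAdelic (↥(maximalRealSubfield L)) L (IsCMField.complexConj L) 3 H)) →
        IsCompact (K' : Set (finAdelic (↥(maximalRealSubfield L)) L (IsCMField.complexConj L) 3 H)) →
        ∀ B : ClosedSubrep (((Gp L H).rightRegular μ).restrict (archToAdelic (↥(maximalRealSubfield L)) L (IsCMField.complexConj L) 3 H)),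
          (∀ w : (Gp L H).L2 μ, w ∈ B.toSubmodule ↔
            (w ∈ (rep (Gp L H) μ c).space.toSubmodule ∧
              ∀ k ∈ K', (Gp L H).rightRegular μ (finAdelicToAdelic (↥(maximalRealSubfield L)) L (IsCMField.complexConj L) 3 H k) w = w)) →
          ∃ (K : Type) (_ : Group K) (_ : TopologicalSpace K) (_ : IsTopologicalGroup K) (_ : CompactSpace K) (_ : T2Space K)
            (ιK : K →* arch (↥(maximalRealSubfield L)) L (IsCMField.complexConj L) 3 H),
            (B.toContRep.restrict ιK).IsStronglyContinuous ∧
            ∀ (F : Submodule ℂ B.toSubmodule) (hF : ∀ k, ∀ v ∈ F, (B.toContRep.restrict ιK) k v ∈ F), FiniteDimensional ℂ F →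
              ((B.toContRep.restrict ιK).subRep F hF).IsIrreducible →
              FiniteDimensional ℂ (Representation.homRangeSum (B.toContRep.restrict ιK).toRepresentation ((B.toContRep.restrict ιK).subRep F hF)))
    (hiso : ∀ c : Cls (Gp L H) μ, cptTriv₀ L ι H T hT μ c →
      ∀ W : ClosedSubrep (((Gp L H).rightRegular μ).restrict (archToAdelic (↥(maximalRealSubfield L)) L (IsCMField.complexConj L) 3 H)),
        W.toSubmodule ≤ (rep (Gp L H) μ c).space.toSubmodule → W.toContRep.IsTopIrreducible →
        ∀ σbar : ContRepresentation ℂ (uFormGroup (Fin 2) (Fin 1)).carrier W.toSubmodule,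
          (∀ g, W.toContRep g = σbar (archProjUForm L ι H T hT g)) →
          IsUnitaryGlobalization (uFormGroup (Fin 2) (Fin 1))
            (clInfChoiceU L H ι T hT μ (archDegOneClass 1 (Or.inl rfl)) (rep (Gp L H) μ c)) σbar)
    (hcore :
      letI : MeasurableSpace (UnitaryGroup.arch (↥(maximalRealSubfield L)) L (IsCMField.complexConj L) 3 H) := borel _
      letI : MeasurableSpace (finAdelic (↥(maximalRealSubfield L)) L (IsCMField.complexConj L) 3 H) := borel _
      haveI : BorelSpace (finAdelic (↥(maximalRealSubfield L)) L (IsCMField.complexConj L) 3 H) := ⟨rfl⟩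
      IsProductHaar L H ν νinf μv →
        ∀ (νf : Measure (finAdelic (↥(maximalRealSubfield L)) L (IsCMField.complexConj L) 3 H)),
          ν = Measure.map (adelicProdEquiv (↥(maximalRealSubfield L)) L (IsCMField.complexConj L) 3 H).symm.toMulEquiv (νinf.prod νf) →
          ∀ c : Cls (Gp L H) μ, cptTriv₀ L ι H T hT μ c →
            ∃ (W : Type) (_ : AddCommGroup W) (_ : Module ℂ W) (σ : Representation ℂ (finAdelic (↥(maximalRealSubfield L)) L (IsCMField.complexConj L) 3 H) W),
              σ.IsIrreducible ∧ σ.IsAdmissible ∧ σ.IsSmooth ∧ (rep (Gp L H) μ c).HasFinComponent σ ∧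
              ∀ (K' : Subgroup (finAdelic (↥(maximalRealSubfield L)) L (IsCMField.complexConj L) 3 H)),
                IsOpen (K' : Set (finAdelic (↥(maximalRealSubfield L)) L (IsCMField.complexConj L) 3 H)) →
                IsCompact (K' : Set (finAdelic (↥(maximalRealSubfield L)) L (IsCMField.complexConj L) 3 H)) →
                ∀ (n : ℕ)
                  (W : Fin n → ClosedSubrep (((Gp L H).rightRegular μ).restrict (archToAdelic (↥(maximalRealSubfield L)) L (IsCMField.complexConj L) 3 H)))
                  (σbar : ∀ i, ContRepresentation ℂ (uFormGroup (Fin 2) (Fin 1)).carrier (W i).toSubmodule),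
                  (∀ i j, i ≠ j → (W i).toSubmodule ⟂ (W j).toSubmodule) →
                  (∀ i, (W i).toSubmodule ≤ (rep (Gp L H) μ c).space.toSubmodule) →
                  (∀ i g, (W i).toContRep g = σbar i (archProjUForm L ι H T hT g)) →
                  (∀ i, IsUnitaryGlobalization (uFormGroup (Fin 2) (Fin 1))
                    (clInfChoiceU L H ι T hT μ (archDegOneClass 1 (Or.inl rfl)) (rep (Gp L H) μ c)) (σbar i)) →
                  (∀ w : (Gp L H).L2 μ, w ∈ (rep (Gp L H) μ c).space.toSubmodule →
                    (∀ k ∈ K', (Gp L H).rightRegular μ (finAdelicToAdelic (↥(maximalRealSubfield L)) L (IsCMField.complexConj L) 3 H k) w = w) →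
                    w ∈ ⨆ i, (W i).toSubmodule) →
                  ∀ (Λ : C_c(finAdelic (↥(maximalRealSubfield L)) L (IsCMField.complexConj L) 3 H, ℂ)),
                    (∀ k ∈ K', ∀ b, Λ (b * k) = Λ b) → (∀ k ∈ K', ∀ b, Λ (k * b) = Λ b) →
                    ∀ (u : Fin n → (Gp L H).L2 μ), (∀ i, u i ∈ (W i).toSubmodule ∧ ‖u i‖ = 1) →
                    ∀ [IsFiniteMeasureOnCompacts νf],
                      ∑ i, ⟪u i, (((Gp L H).rightRegular μ).restrict (finAdelicToAdelic (↥(maximalRealSubfield L)) L (IsCMField.complexConj L) 3 H)).integratedOperator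
                          (((Gp L H).isUnitary_rightRegular μ).restrict _)
                          (((Gp L H).isStronglyContinuous_rightRegular_holds μ).restrict _
                            (continuous_finAdelicToAdelic (↥(maximalRealSubfield L)) L (IsCMField.complexConj L) 3 H)) νf Λ (u i)⟫_ℂ =
                        σ.smoothTrace νf ⇑Λ) :
    letI : MeasurableSpace (UnitaryGroup.arch (↥(maximalRealSubfield L)) L (IsCMField.complexConj L) 3 H) := borel _
    letI : MeasurableSpace (finAdelic (↥(maximalRealSubfield L)) L (IsCMField.complexConj L) 3 H) := borel _
    haveI : BorelSpace (finAdelic (↥(maximalRealSubfield L)) L (IsCMField.complexConj L) 3 H) := ⟨rfl⟩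
    IsProductHaar L H ν νinf μv →
      ∀ (νf : Measure (finAdelic (↥(maximalRealSubfield L)) L (IsCMField.complexConj L) 3 H)),
        ν = Measure.map (adelicProdEquiv (↥(maximalRealSubfield L)) L (IsCMField.complexConj L) 3 H).symm.toMulEquiv (νinf.prod νf) →
        ∀ c : Cls (Gp L H) μ, cptTriv₀ L ι H T hT μ c →
          ∃ (W : Type) (_ : AddCommGroup W) (_ : Module ℂ W) (σ : Representation ℂ (finAdelic (↥(maximalRealSubfield L)) L (IsCMField.complexConj L) 3 H) W),
            σ.IsIrreducible ∧ σ.IsAdmissible ∧ σ.IsSmooth ∧ (rep (Gp L H) μ c).HasFinComponent σ ∧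
            ∀ (K' : Subgroup (finAdelic (↥(maximalRealSubfield L)) L (IsCMField.complexConj L) 3 H)),
              IsOpen (K' : Set (finAdelic (↥(maximalRealSubfield L)) L (IsCMField.complexConj L) 3 H)) →
              IsCompact (K' : Set (finAdelic (↥(maximalRealSubfield L)) L (IsCMField.complexConj L) 3 H)) →
              ∃ (n : ℕ)
                (W : Fin n → ClosedSubrep (((Gp L H).rightRegular μ).restrict (archToAdelic (↥(maximalRealSubfield L)) L (IsCMField.complexConj L) 3 H)))
                (σbar : ∀ i, ContRepresentation ℂ (uFormGroup (Fin 2) (Fin 1)).carrier (W i).toSubmodule),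
                (∀ i j, i ≠ j → (W i).toSubmodule ⟂ (W j).toSubmodule) ∧
                (∀ i, (W i).toSubmodule ≤ (rep (Gp L H) μ c).space.toSubmodule) ∧
                (∀ i g, (W i).toContRep g = σbar i (archProjUForm L ι H T hT g)) ∧
                (∀ i, IsUnitaryGlobalization (uFormGroup (Fin 2) (Fin 1))
                  (clInfChoiceU L H ι T hT μ (archDegOneClass 1 (Or.inl rfl)) (rep (Gp L H) μ c)) (σbar i)) ∧
                (∀ w : (Gp L H).L2 μ, w ∈ (rep (Gp L H) μ c).space.toSubmodule →
                  (∀ k ∈ K', (Gp L H).rightRegular μ (finAdelicToAdelic (↥(maximalRealSubfield L)) L (IsCMField.complexConj L) 3 H k) w = w) →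
                  w ∈ ⨆ i, (W i).toSubmodule) ∧
                (∀ (Λ : C_c(finAdelic (↥(maximalRealSubfield L)) L (IsCMField.complexConj L) 3 H, ℂ)),
                  (∀ k ∈ K', ∀ b, Λ (b * k) = Λ b) → (∀ k ∈ K', ∀ b, Λ (k * b) = Λ b) →
                  ∀ (u : Fin n → (Gp L H).L2 μ), (∀ i, u i ∈ (W i).toSubmodule ∧ ‖u i‖ = 1) →
                  ∀ [IsFiniteMeasureOnCompacts νf],
                    ∑ i, ⟪u i, (((Gp L H).rightRegular μ).restrict (finAdelicToAdelic (↥(maximalRealSubfield L)) L (IsCMField.complexConj L) 3 H)).integratedOperator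
                        (((Gp L H).isUnitary_rightRegular μ).restrict _)
                        (((Gp L H).isStronglyContinuous_rightRegular_holds μ).restrict _
                          (continuous_finAdelicToAdelic (↥(maximalRealSubfield L)) L (IsCMField.complexConj L) 3 H)) νf Λ (u i)⟫_ℂ =
                      σ.smoothTrace νf ⇑Λ) := by
  intro hPH νf hν c hc
  obtain ⟨Wσ, i1, i2, σ, hirr, hadmσ, hsm, hfin, hK⟩ := hcore hPH νf hν c hc
  refine ⟨Wσ, i1, i2, σ, hirr, hadmσ, hsm, hfin, fun K' hKo hKc => ?_⟩
  -- the ambient representation of `G′_∞` on `L²`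
  have hRu : ((Gp L H).rightRegular μ).IsUnitary := (Gp L H).isUnitary_rightRegular μ
  have hRc : ((Gp L H).rightRegular μ).IsStronglyContinuous := (Gp L H).isStronglyContinuous_rightRegular_holds μ
  have hπu : (((Gp L H).rightRegular μ).restrict (archToAdelic (↥(maximalRealSubfield L)) L (IsCMField.complexConj L) 3 H)).IsUnitary :=
    hRu.restrict _
  have hπc : (((Gp L H).rightRegular μ).restrict (archToAdelic (↥(maximalRealSubfield L)) L (IsCMField.complexConj L) 3 H)).IsStronglyContinuous :=
    hRc.restrict _ (continuous_archToAdelic (↥(maximalRealSubfield L)) L (IsCMField.complexConj L) 3 H)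
  -- the level-`K'` block `B` of `rep c` (an opaque witness with its membership characterisation)
  obtain ⟨B, hBchar⟩ : ∃ B : ClosedSubrep (((Gp L H).rightRegular μ).restrict (archToAdelic (↥(maximalRealSubfield L)) L (IsCMField.complexConj L) 3 H)),
      ∀ w : (Gp L H).L2 μ, w ∈ B.toSubmodule ↔
        (w ∈ (rep (Gp L H) μ c).space.toSubmodule ∧
          ∀ k ∈ K', (Gp L H).rightRegular μ (finAdelicToAdelic (↥(maximalRealSubfield L)) L (IsCMField.complexConj L) 3 H k) w = w) :=
   ⟨{ toSubmodule :=
        { carrier := {w | w ∈ (rep (Gp L H) μ c).space.toSubmodule ∧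
            ∀ k ∈ K', (Gp L H).rightRegular μ (finAdelicToAdelic (↥(maximalRealSubfield L)) L (IsCMField.complexConj L) 3 H k) w = w}
          add_mem' := fun {a b} ha hb => ⟨Submodule.add_mem _ ha.1 hb.1, fun k hk => by rw [map_add, ha.2 k hk, hb.2 k hk]⟩
          zero_mem' := ⟨Submodule.zero_mem _, fun k _ => map_zero _⟩
          smul_mem' := fun a {w} hw => ⟨Submodule.smul_mem _ a hw.1, fun k hk => by rw [map_smul, hw.2 k hk]⟩ }
      apply_mem_toSubmodule := fun g {w} hw => by
        refine ⟨(rep (Gp L H) μ c).space.apply_mem (archToAdelic (↥(maximalRealSubfield L)) L (IsCMField.complexConj L) 3 H g) hw.1,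
          fun k hk => ?_⟩
        change (Gp L H).rightRegular μ (finAdelicToAdelic _ L _ 3 H k)
            ((Gp L H).rightRegular μ (archToAdelic _ L _ 3 H g) w) = (Gp L H).rightRegular μ (archToAdelic _ L _ 3 H g) w
        have hmul : ∀ (a b : (Gp L H).Adelic) (w' : (Gp L H).L2 μ),
            (Gp L H).rightRegular μ (a * b) w' = (Gp L H).rightRegular μ a ((Gp L H).rightRegular μ b w') := fun a b w' => by
          rw [map_mul]; rfl
        rw [← hmul, ← (commute_archToAdelic_finAdelicToAdelic (↥(maximalRealSubfield L)) L (IsCMField.complexConj L) 3 H g k).eq, hmul,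
          hw.2 k hk]
      isClosed' := by
        change IsClosed {w : (Gp L H).L2 μ | w ∈ (rep (Gp L H) μ c).space.toSubmodule ∧
            ∀ k ∈ K', (Gp L H).rightRegular μ (finAdelicToAdelic (↥(maximalRealSubfield L)) L (IsCMField.complexConj L) 3 H k) w = w}
        have h1 : IsClosed {w : (Gp L H).L2 μ |
            ∀ k ∈ K', (Gp L H).rightRegular μ (finAdelicToAdelic (↥(maximalRealSubfield L)) L (IsCMField.complexConj L) 3 H k) w = w} := by
          rw [Set.setOf_forall]
          refine isClosed_iInter fun k => ?_
          by_cases hk : k ∈ K'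
          · have h3 : {w : (Gp L H).L2 μ | k ∈ K' →
                  (Gp L H).rightRegular μ (finAdelicToAdelic (↥(maximalRealSubfield L)) L (IsCMField.complexConj L) 3 H k) w = w} =
                {w | (Gp L H).rightRegular μ (finAdelicToAdelic (↥(maximalRealSubfield L)) L (IsCMField.complexConj L) 3 H k) w = w} := by
              ext w; simp only [Set.mem_setOf_eq, hk, forall_true_left]
            rw [h3]
            exact isClosed_eq ((Gp L H).rightRegular μ _).continuous continuous_id
          · have h3 : {w : (Gp L H).L2 μ | k ∈ K' →
                  (Gp L H).rightRegular μ (finAdelicToAdelic (↥(maximalRealSubfield L)) L (IsCMField.complexConj L) 3 H k) w = w} = Set.univ := by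
              ext w; simp only [Set.mem_setOf_eq, hk, IsEmpty.forall_iff, Set.mem_univ]
            rw [h3]
            exact isClosed_univ
        have h2 : IsClosed {w : (Gp L H).L2 μ | w ∈ (rep (Gp L H) μ c).space.toSubmodule} := (rep (Gp L H) μ c).space.isClosed
        rw [Set.setOf_and]
        exact h2.inter h1 }, fun w => Iff.rfl⟩
  have hBle : B.toSubmodule ≤ (rep (Gp L H) μ c).space.toSubmodule := fun w hw => ((hBchar w).1 hw).1
  have hBu : B.toContRep.IsUnitary := hπu.toContRep B
  have hBc : B.toContRep.IsStronglyContinuous := fun v => by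
    have h1 : Continuous fun g => ((B.toContRep g v : B.toSubmodule) : (Gp L H).L2 μ) := by
      simp only [ClosedSubrep.coe_toContRep_apply]
      exact hπc (v : (Gp L H).L2 μ)
    exact continuous_induced_rng.2 h1
  -- inflated blocks lie in `rep c`
  have hinfl_le : ∀ Wb : ClosedSubrep B.toContRep, (B.inflate Wb).toSubmodule ≤ (rep (Gp L H) μ c).space.toSubmodule :=
    fun Wb v hv => hBle ((B.inflate_le Wb) hv)
  -- L-adm
  obtain ⟨K, iK₁, iK₂, iK₃, iK₄, iK₅, ιK, hcK, hadmB⟩ := hadm c hc K' hKo hKc B hBchar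
  have hkerB : ∀ g, archProjUForm L ι H T hT g = 1 → B.toContRep g = 1 := toContRep_eq_one_of_cptTriv₀ L H ι T hT μ c hc B hBle
  -- ★ p838816 on `B`; its `hiso` binder (= L-iso in `B`-relative form) is produced by §0's one-level lemmas at `π := B.toContRep`:
  -- descent (`exists_descend_toContRep`), class from `hiso` on the INFLATED block + transport (`isUnitaryGlobalization_of_descend_of_areUnitarilyEquivalent`)
  obtain ⟨n, Wb, -, horthb, hirrb, -, -, htop⟩ :=
    exists_fin_orthogonal_blocks_of_admissible_of_descend L ι H T hT
      (x := clInfChoiceU L H ι T hT μ (archDegOneClass 1 (Or.inl rfl)) (rep (Gp L H) μ c)) hBu ιK hcK hadmB (fun Wb hWb => by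
        -- the same block, read as a `ClosedSubrep B.toContRep` in the ambient spelling
        let Wr : ClosedSubrep B.toContRep := Wb
        have hirr' : (B.inflate Wr).toContRep.IsTopIrreducible := (B.isTopIrreducible_inflate_iff Wr).2 hWb
        obtain ⟨σ', hσ'⟩ := exists_descend_archProjUForm L ι H T hT (B.inflate Wr).toContRep
          (toContRep_eq_one_of_cptTriv₀ L H ι T hT μ c hc (B.inflate Wr) (hinfl_le Wr))
        have hglob' := hiso c hc (B.inflate Wr) (hinfl_le Wr) hirr' σ' hσ'
        obtain ⟨σb, hσb⟩ := exists_descend_toContRep L ι H T hT hkerB Wb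
        exact ⟨σb, hσb, isUnitaryGlobalization_of_descend_of_areUnitarilyEquivalent L ι H T hT hBu hBc Wb hσb hσ'
          (B.areUnitarilyEquivalent_inflate Wr).symm hglob'⟩)
  -- the blocks, read as `ClosedSubrep B.toContRep` in the ambient spelling; inflate to `L²` and descend afresh
  let Wr : Fin n → ClosedSubrep B.toContRep := Wb
  have horthr : ∀ i j, i ≠ j → (Wr i).toSubmodule ⟂ (Wr j).toSubmodule := horthb
  have hirrr : ∀ i, (Wr i).toContRep.IsTopIrreducible := hirrb
  have htopr : (⨆ i, (Wr i).toSubmodule) = ⊤ := htop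
  choose σbar hσbar using fun i => exists_descend_archProjUForm L ι H T hT (B.inflate (Wr i)).toContRep
    (toContRep_eq_one_of_cptTriv₀ L H ι T hT μ c hc (B.inflate (Wr i)) (hinfl_le (Wr i)))
  have horth : ∀ i j, i ≠ j → (B.inflate (Wr i)).toSubmodule ⟂ (B.inflate (Wr j)).toSubmodule :=
    fun i j hij => (B.isOrtho_inflate_iff).2 (horthr i j hij)
  have hle : ∀ i, (B.inflate (Wr i)).toSubmodule ≤ (rep (Gp L H) μ c).space.toSubmodule := fun i => hinfl_le (Wr i)
  have hglob : ∀ i, IsUnitaryGlobalization (uFormGroup (Fin 2) (Fin 1))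
      (clInfChoiceU L H ι T hT μ (archDegOneClass 1 (Or.inl rfl)) (rep (Gp L H) μ c)) (σbar i) := fun i =>
    hiso c hc (B.inflate (Wr i)) (hle i) ((B.isTopIrreducible_inflate_iff (Wr i)).2 (hirrr i)) (σbar i) (hσbar i)
  have hexh : ∀ w : (Gp L H).L2 μ, w ∈ (rep (Gp L H) μ c).space.toSubmodule →
      (∀ k ∈ K', (Gp L H).rightRegular μ (finAdelicToAdelic (↥(maximalRealSubfield L)) L (IsCMField.complexConj L) 3 H k) w = w) →
      w ∈ ⨆ i, (B.inflate (Wr i)).toSubmodule := by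
    intro w hw hfix
    have hwB : w ∈ B.toSubmodule := (hBchar w).2 ⟨hw, hfix⟩
    have h1 : (⟨w, hwB⟩ : B.toSubmodule) ∈ ⨆ i, (Wr i).toSubmodule := by rw [htopr]; exact Submodule.mem_top
    have h2 : w ∈ (⨆ i, (Wr i).toSubmodule).map B.toSubmodule.subtype := ⟨⟨w, hwB⟩, h1, rfl⟩
    rw [Submodule.map_iSup] at h2
    simpa only [ClosedSubrep.toSubmodule_inflate] using h2
  exact ⟨n, fun i => B.inflate (Wr i), σbar, horth, hle, hσbar, hglob, hexh,
    hK K' hKo hKc n (fun i => B.inflate (Wr i)) σbar horth hle hσbar hglob hexh⟩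

end Summit.HodgeConjecture.HodgeConjecture.Cruxes.H413.F0P3ArchStructureLetterSplit

end
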